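import Literature.AlgebraicGeometry.HodgeTheory.WeilFamilyReach
import HarnessLib

/-!
# Deligne's polarized Weil family over the hyperbolic component — family-first, with the Weil sub-local system (named fact)

For `K = ℚ(√-d)` and a complex abelian `2n`-fold `(P, ψ₀)`, `ψ₀ ∘ ψ₀ = -d`, of HYPERBOLIC (= split) Weil
type for a `K`-compatible polarization, Deligne constructs in the proof of [Deligne1982HodgeCycles, Thm. 4.8]
(LNM 900, pp. 47–52) the algebraic family of polarized abelian varieties with `ℤ[ψ₀]`-action through `P`:
the quotient `Γ\X⁺` of the Hermitian symmetric domain of `K`-compatible complex structures positive for the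
polarization by a torsion-free congruence subgroup `Γ ⊂ SU(Λ, H)`, a smooth connected quasi-projective
variety carrying a projective universal abelian scheme ([MumfordFogartyKirwan1994, Thm. 7.9–7.10]; Deligne,
loc. cit., p. 50). Along it the Weil planes `⋀^{2n}_K H¹ ⊂ H^{2n}` of the fibres form a sub-local system
on which the monodromy acts through `det_K = 1`, i.e. TRIVIALLY ("`Γ ⊂ SU`, so `det_K γ = 1`", p. 50;
[vanGeemen1994HodgeAV, 5.8–5.11]): every Weil class of `P` extends to a flat section whose value on every
fibre is a Weil class of that fibre, of Hodge type `(n, n)` there (all fibres are of Weil type `(n, n)`,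
[Deligne1982HodgeCycles, Prop. 4.4]). By Landherr's classification of `K`-Hermitian forms (rank, signature,
discriminant; [Landherr1936HermitianForms]; [vanGeemen1994HodgeAV, 5.3–5.4]) every other hyperbolic
`(A, φ, h)` of the same dimension has an isometric `(H₁(A, ℚ), H_A) ≅ (H₁(P, ℚ), H_P)`, hence is
`K`-isogenous to a fibre of THIS family (commensurable lattices; isogenies are finite flat,
[Milne1986AbelianVarieties, §8 Prop. 8.1]).

This file records that package as ONE named fact, `weilFamily_hyperbolic_weilSystem_reach`, on the tree's
real carriers and in the shape of its accepted sibling `weilFamilyReach_hyperbolic`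
(`HodgeTheory/WeilFamilyReach`), from which it differs in BOOKKEEPING only:

* the quantifiers are in the order the source proves them — ONE family per polarized `(P, ψ₀, h_K)`
  (`∃ family, ∀ Weil class w, ∃ flat section through w` and `∀ hyperbolic target, ∃ reaching fibre`),
  where `weilFamilyReach_hyperbolic` fixes the Weil class and the target before producing the family
  (`∀ w, ∀ A, ∃ family`) — a consumer that must serve EVERY Weil class of `P` with ONE family (e.g. the
  reach stub of crux `WeilTwelvefoldsSqrtMinus7`, line `isotypic-unimodular-saturation`, which globalises
  all rational `(7,7)` Weil classes of a fixed `A × B` over one family) cannot use the sibling;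
* the `√-d`-multiplications `(Y_s, Ψ_s) ≅ 𝒳_s` of ALL fibres are recorded (functions of `s`), and the flat
  Weil sections are asserted to take values in the Weil planes `weilClassesOf (Y_s) (Ψ_s) n d` on EVERY
  fibre (the sub-local system), not only at the reached fibre;
* the reaching `K`-isogeny is oriented FROM the fibre: `u : Y_s → A` finite flat, `v : A → Y_s`,
  `v ∘ u = [m]`, `v` intertwining `φ` and `Ψ_s` (the orientation consumed by isogeny descent of Weil
  classes, `HodgeTheory/WeilClassesIsogenyDescent`);
* the relative polarization class and the non-vanishing of transported classes (clauses of the sibling)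
  are not repeated.

## Rendering (design choices)

As in `HodgeTheory/WeilFamilyReach` and `HodgeTheory/WeilFamilyFlatSections`: `P : Motives.AbelianVariety ℂ`
with `ψ₀ : P ⟶ P`, `ψ₀ ≫ ψ₀ = -((d : ℤ) • 𝟙 P)`, `P.dim = 2n`; hyperbolicity
`Motives.IsHyperbolicWeilType P ψ₀ n h_K` for the `K`-symmetrised hyperplane class
`h_K = d·e^*a + ψ₀^*e^*a` of a projective embedding `e : Motives.ProjectiveEmbedding P.X` and a non-zero
rational `a ∈ H²(ℙᴺ(ℂ); ℂ)` (so `h_K = ±q·c₁(M)` with `M` ample and `K`-compatible; hyperbolic for `h_K`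
⟺ the `K`-Hermitian form of `M` has Witt index `n`, which forces Weil type `(n, n)`); the family
`f : 𝒳 ⟶ S` with `Motives.IsSmoothProjectiveFamily f (2n)`, embedded in `ℙᴺ × S`, base irreducible, smooth,
quasi-projective (`IsQuasiProjectiveOver`); `e' : P.X ≅ 𝒳_{s₀}`; fibre structures
`Y : S(ℂ) → AbelianVariety ℂ`, `Ψ s : Y s ⟶ Y s`, `ε s : (Y s).X ≅ 𝒳_s`; Weil classes in the STRONG typing
`weilClassesOf` (`HodgeTheory/WeilClasses`); flat sections as CONTINUOUS sections of the étalé space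
`FiberClass f (2n)` of `R^{2n} f_* ℂ` (`HodgeTheory/HodgeLocus`), their values written `σ s = ⟨s, x⟩` to
keep the fibre index definitional; Hodge type `IsOfHodgeType (2n) 𝒳_s (2n) n n x`.

What is NOT here: the algebraicity of anything; the theorem of the fixed part / Leray degeneration that
turns a flat section into a class of the total space (`deligne_globalInvariantCycles`,
`deligne1968_invariantClass_fromTotalSpace`); rationality along flat sections (proved in the tree); reach
of NON-hyperbolic components (other discriminants: same proof with Landherr's invariant `det H`, not
needed by the consumers, which aim their products onto the hyperbolic component —
`Motives/AimedSplitProduct`). The tree constructs no moduli space of abelian varieties, no universal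
abelian scheme and no period map (2026-08-16), which is why this is a NAMED FACT.

## References

* [Deligne1982HodgeCycles] P. Deligne (notes by J. Milne), Hodge cycles on abelian varieties, LNM 900
  (1982), proof of Thm. 4.8 (pp. 47–52), Prop. 4.4.
* [vanGeemen1994HodgeAV] B. van Geemen, LNM 1594 (1994), Lemma 5.2, 5.3–5.4, 5.8–5.11.
* [Landherr1936HermitianForms] W. Landherr, Abh. Math. Sem. Hamburg 11 (1936).
* [MumfordFogartyKirwan1994] GIT, 3rd ed., Thm. 7.9–7.10.
* [Milne1986AbelianVarieties] J. S. Milne, Abelian Varieties, §8 Prop. 8.1.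
-/

noncomputable section

namespace Literature.AlgebraicGeometry.HodgeTheory

open CategoryTheory
open Literature.AlgebraicGeometry Literature.AlgebraicGeometry.Motives
open Literature.AlgebraicTopology.SingularHomology

/-- **Deligne's polarized Weil family through a hyperbolic abelian `2n`-fold: `K`-structures on all
fibres, the flat Weil sub-local system, and reach of every hyperbolic `(A, φ)` up to `K`-isogeny**
(NAMED FACT; the accepted fact `weilFamilyReach_hyperbolic` with its quantifiers in the order of the
source — ONE family per polarized `(P, ψ₀, h_K)`, serving every Weil class and every target — and the
Weil planes of all fibres recorded). Let `n, d ≥ 1`, `K = ℚ(√-d)`, and let `(P, ψ₀)` be a complex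
abelian `2n`-fold with `ψ₀ ≫ ψ₀ = -d`, HYPERBOLIC (`IsHyperbolicWeilType`: a `ψ₀^*`-stable rational
Lagrangian `2n`-frame of `H¹`) for the `K`-symmetrised hyperplane class `h_K = d·e^*a + ψ₀^*e^*a` of a
projective embedding `e` and a non-zero rational `a ∈ H²(ℙᴺ(ℂ); ℂ)` (`h_K = ±q·c₁(M)`, `M` ample and
`K`-compatible, so the `K`-Hermitian form `H_M` on `H₁(P, ℚ)` has Witt index `n` and `(P, K)` is of Weil
type `(n, n)`, [vanGeemen1994HodgeAV, Lemma 5.2, 5.4]). Let `f : 𝒳 → S` be the universal polarized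
abelian scheme with `ℤ[ψ₀]`-action over the connected component `S = Γ\X⁺` through the moduli point
`s₀` of `(P, M, ψ₀)` of the fine moduli scheme of this PEL type with neat level (`Γ ⊂ SU(H₁(P, ℤ), H_M)`
torsion free; `S` smooth, connected, quasi-projective; `f` projective: [Deligne1982HodgeCycles, proof of
Thm. 4.8, pp. 48–50]; [MumfordFogartyKirwan1994, Thm. 7.9–7.10]), `e' : P ≅ 𝒳_{s₀}`, and
`(Y_s, Ψ_s) ≅ 𝒳_s` its fibres with their `√-d`-multiplication (`Ψ_s² = -d`, `dim Y_s = 2n`). Then: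
(a) ("`Γ ⊂ SU`, so `det_K γ = 1`", loc. cit. p. 50; [vanGeemen1994HodgeAV, 5.8–5.11]) EVERY Weil class
`w ∈ ⋀^{2n}_K H¹(P) ⊗ ℂ = weilClassesOf P ψ₀ n d` extends to a CONTINUOUS (= flat) section `σ` of
`R^{2n} f_* ℂ` (`FiberClass f (2n)`) with `σ(s₀) = (s₀, e'^{-1*} w)`, whose value at every `s` is a
Weil class of `(Y_s, Ψ_s)` (the Weil planes `⋀^{2n}_K R¹f_*ℚ` form a sub-local system) and is therefore
of Hodge type `(n, n)` on EVERY fibre (all fibres are of Weil type `(n, n)`: clause (a) of loc. cit. with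
[Deligne1982HodgeCycles, Prop. 4.4]); (b) REACH: for every abelian `2n`-fold `(A, φ)`, `φ ≫ φ = -d`,
hyperbolic for its own `K`-symmetrised hyperplane class, the `K`-Hermitian spaces `(H₁(A, ℚ), H_A)` and
`(H₁(P, ℚ), ±H_M)` are both hyperbolic of rank `2n` over `K`, hence isometric
([Landherr1936HermitianForms]; [vanGeemen1994HodgeAV, 5.3–5.4]); the isometry carries the complex
structure of `A` to a point `s` of the SAME connected domain, so `A` is `K`-ISOGENOUS to the fibre
`(Y_s, Ψ_s)` (commensurable lattices in `H₁(P, ℚ)`): an isogeny `u : Y_s → A` (finite flat,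
[Milne1986AbelianVarieties, §8 Prop. 8.1]) with `v : A → Y_s`, `v ∘ u = [m]`, `m ≥ 1`, `v` intertwining
`φ` and `Ψ_s`. On the tree's real carriers, in the shape of `weilFamilyReach_hyperbolic` /
`deligne1982_weilFamily_hodgeWeilSection`. The tree constructs no moduli space of abelian varieties, no
universal abelian scheme and no period map, which is why this is a NAMED FACT.
[cite: Deligne1982HodgeCycles, proof of Thm. 4.8 (pp. 47–52) with Prop. 4.4]
[cite: vanGeemen1994HodgeAV, Lemma 5.2, 5.3–5.4 and 5.8–5.11]
[cite: Landherr1936HermitianForms, Satz (classification by rank, discriminant, signatures)]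
[cite: MumfordFogartyKirwan1994, Thm. 7.9–7.10] [cite: Milne1986AbelianVarieties, §8 Prop. 8.1]
-/
def weilFamily_hyperbolic_weilSystem_reach : Prop :=
  ∀ (n d : ℕ), 1 ≤ n → 1 ≤ d →
    ∀ (P : AbelianVariety ℂ) (ψ₀ : P ⟶ P) (e : ProjectiveEmbedding P.X)
      (a : complexBetti (projectiveSpace e.n ℂ) 2),
      P.dim = 2 * n → ψ₀ ≫ ψ₀ = -((d : ℤ) • 𝟙 P) → IsRationalClass a → a ≠ 0 →
      IsHyperbolicWeilType P ψ₀ n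
        ((d : ℂ) • complexBetti.map e.ι 2 a + complexBetti.map ψ₀.hom.hom.hom 2 (complexBetti.map e.ι 2 a)) →
      ∃ (𝒳 S : SchemeOver ℂ) (f : 𝒳 ⟶ S) (s₀ : ComplexPoints S) (e' : P.X ≅ fiberOver f s₀)
        (Y : ComplexPoints S → AbelianVariety ℂ) (Ψ : ∀ s, Y s ⟶ Y s)
        (ε : ∀ s, (Y s).X ≅ fiberOver f s),
        IsSmoothProjectiveFamily f (2 * n) ∧
        (∃ (N : ℕ) (ι : 𝒳 ⟶ CategoryTheory.MonoidalCategoryStruct.tensorObj (projectiveSpace N ℂ) S),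
          AlgebraicGeometry.IsClosedImmersion ι.left ∧
            ι ≫ CategoryTheory.CartesianMonoidalCategory.snd (projectiveSpace N ℂ) S = f) ∧
        IrreducibleSpace S.left ∧ AlgebraicGeometry.Smooth S.hom ∧ IsQuasiProjectiveOver S ∧
        (∀ s, (Y s).dim = 2 * n ∧ Ψ s ≫ Ψ s = -((d : ℤ) • 𝟙 (Y s))) ∧
        (∀ w : complexBetti P.X (2 * n), w ∈ weilClassesOf P ψ₀ n d →
          ∃ σ : ComplexPoints S → FiberClass f (2 * n),
            Continuous σ ∧ σ s₀ = ⟨s₀, complexBetti.map e'.inv (2 * n) w⟩ ∧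
            ∀ s, ∃ x : complexBetti (fiberOver f s) (2 * n), σ s = ⟨s, x⟩ ∧
              IsOfHodgeType (2 * n) (fiberOver f s) (2 * n) n n x ∧
              complexBetti.map (ε s).hom (2 * n) x ∈ weilClassesOf (Y s) (Ψ s) n d) ∧
        ∀ (A : AbelianVariety ℂ) (φ : A ⟶ A) (eA : ProjectiveEmbedding A.X)
          (aA : complexBetti (projectiveSpace eA.n ℂ) 2),
          A.dim = 2 * n → φ ≫ φ = -((d : ℤ) • 𝟙 A) → IsRationalClass aA → aA ≠ 0 →
          IsHyperbolicWeilType A φ n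
            ((d : ℂ) • complexBetti.map eA.ι 2 aA +
              complexBetti.map φ.hom.hom.hom 2 (complexBetti.map eA.ι 2 aA)) →
          ∃ (s : ComplexPoints S) (u : Y s ⟶ A) (v : A ⟶ Y s) (m : ℕ),
            AlgebraicGeometry.Flat u.hom.hom.hom.left ∧ 0 < m ∧ u ≫ v = m • 𝟙 (Y s) ∧
              v ≫ Ψ s = φ ≫ v

end Literature.AlgebraicGeometry.HodgeTheory

end
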